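import Summits.CriticalPhenomena.SAWScalingLimit.Theses.SAWExpectedSignature
import Summits.CriticalPhenomena.SAWScalingLimit.Theorems.SAWWeldingIdentificationEventualTightOfPVariation

/-!
# `PVarMomentsTight` (stmt-CriticalPhenomena-5892): the glue `PVarMoments → EventualTight` of route `SAWExpectedSignature`

The support item stmt-CriticalPhenomena-5892 of route `SAWExpectedSignature` is the glue
`PVarMoments → EventualTight`: uniform-in-`δ` moment bounds on the `p`-variation (some `p ∈ [1, 2)`)
of the pushed critical SAW polylines give eventual tightness of their laws along the mesh
(`IsTightAlongMesh`, the form consumed by the route's Prokhorov criterion).  Proof: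

1. Markov's inequality with `n = 1`: `P_δ[m ≤ V_p] ≤ C₁ / m` for `δ ∈ (0, δ₀]`, so the level
   `m = (C₁ + 1)/θ` has mass `≤ θ`;
2. monotonicity of the `p`-variation in the exponent (Friz–Victoir Prop. 5.3,
   `Curve.pVariation_le_rpow_rpow`: `V_2 ≤ (V_p^{1/p})^2` for `p ≤ 2`) turns this into tightness of
   the random variable `V_2` — ONE exponent for all domains, as the landed rung wants;
3. the rung `eventualTight_of_pVariationTight` (crux stmt-CriticalPhenomena-1372, line `Sketch`,
   strategist s3-B; `…EventualTightOfPVariation.lean`, Aizenman–Burchard Lemma 4.1 through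
   `CurveClass.isCompact_closure_image_mk_of_pVariation_le`) gives set-level tightness on an initial
   mesh interval, and `isTightAlongMesh_of_isTightMeasureSet_image` the along-mesh form (the SAW
   space carries the discrete σ-algebra, so the curve map is measurable).

The route's inline functional `pv` IS `Curve.pVariation` (definitionally, `Curve.pVariation_eq_iSup`).
[cite: AizenmanBurchardDuke1999, Lemma 4.1] [cite: FrizVictoir2010, Prop. 5.3]
-/

noncomputable section

open MeasureTheory Filter Topology Set Metric
open scoped ENNReal NNReal unitInterval
open Literature.Probability.RandomPlanarGeometry Literature.Probability.LatticeModels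

namespace Summit.CriticalPhenomena.SAWScalingLimit.Theorems

open Summit.CriticalPhenomena.SAWScalingLimit.Theses

/-- **Markov + exponent monotonicity**: a uniform first-moment bound on `V_p`, `0 < p ≤ 2`, over the
meshes `δ ∈ (0, δ₀]` makes `V_2` a tight random variable uniformly in those meshes: for every
`θ > 0` some real level `M ≥ 0` has `P_δ[M < V_2(γ_δ)] ≤ θ` for all `δ ∈ (0, δ₀]`.
[cite: FrizVictoir2010, Prop. 5.3] -/
theorem exists_level_pVariation_two_le_of_lintegral_le {D : DobrushinDomain} {a b : ℝ → Site 2}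
    {p : ℝ} (hp : 0 < p) (hp2 : p ≤ 2) {δ₀ : ℝ} {C : ℝ≥0∞} (hC : C ≠ ⊤)
    (hbound : ∀ δ ∈ Set.Ioc (0 : ℝ) δ₀,
      ∫⁻ γ, (⟨γ.walk.toCurve (meshPoint δ)⟩ : Curve ℂ).pVariation p
        ∂(SAW.law D.carrier δ (a δ) (b δ)) ≤ C)
    {θ : ℝ} (hθ : 0 < θ) :
    ∃ M : ℝ, 0 ≤ M ∧ ∀ δ ∈ Set.Ioc (0 : ℝ) δ₀,
      SAW.law D.carrier δ (a δ) (b δ)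
        {γ | ENNReal.ofReal M < (⟨γ.walk.toCurve (meshPoint δ)⟩ : Curve ℂ).pVariation 2} ≤
        ENNReal.ofReal θ := by
  -- the Markov level for `V_p`
  set m : ℝ≥0∞ := (C + 1) / ENNReal.ofReal θ with hm
  have hθ' : ENNReal.ofReal θ ≠ 0 := (ENNReal.ofReal_pos.2 hθ).ne'
  have hm0 : m ≠ 0 := by
    rw [hm]
    exact ENNReal.div_ne_zero.2 ⟨by simp, ENNReal.ofReal_ne_top⟩
  have hmtop : m ≠ ⊤ := by
    rw [hm]
    exact ENNReal.div_ne_top (by simpa using hC) hθ'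
  -- the corresponding level for `V_2`
  set L : ℝ≥0∞ := (m ^ (1 / p)) ^ (2 : ℝ) with hL
  have hLtop : L ≠ ⊤ :=
    ENNReal.rpow_ne_top_of_nonneg (by norm_num)
      (ENNReal.rpow_ne_top_of_nonneg (one_div_pos.2 hp).le hmtop)
  refine ⟨L.toReal, ENNReal.toReal_nonneg, fun δ hδ => ?_⟩
  have hmeas : AEMeasurable
      (fun γ : SAW.DomainSAW D.carrier δ (a δ) (b δ) =>
        (⟨γ.walk.toCurve (meshPoint δ)⟩ : Curve ℂ).pVariation p)
      (SAW.law D.carrier δ (a δ) (b δ)) :=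
    (SAW.DomainSAW.measurable_of_top _).aemeasurable
  calc SAW.law D.carrier δ (a δ) (b δ)
        {γ | ENNReal.ofReal L.toReal < (⟨γ.walk.toCurve (meshPoint δ)⟩ : Curve ℂ).pVariation 2}
      ≤ SAW.law D.carrier δ (a δ) (b δ)
          {γ | m ≤ (⟨γ.walk.toCurve (meshPoint δ)⟩ : Curve ℂ).pVariation p} := by
        refine measure_mono fun γ hγ => ?_
        simp only [mem_setOf_eq] at hγ ⊢
        rw [ENNReal.ofReal_toReal hLtop] at hγ
        by_contra hlt
        rw [not_le] at hlt
        refine (lt_irrefl L) (hγ.trans_le ?_)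
        calc (⟨γ.walk.toCurve (meshPoint δ)⟩ : Curve ℂ).pVariation 2
            ≤ (((⟨γ.walk.toCurve (meshPoint δ)⟩ : Curve ℂ).pVariation p) ^ (1 / p)) ^ (2 : ℝ) :=
              Curve.pVariation_le_rpow_rpow _ hp hp2
          _ ≤ (m ^ (1 / p)) ^ (2 : ℝ) :=
              ENNReal.rpow_le_rpow (ENNReal.rpow_le_rpow hlt.le (one_div_pos.2 hp).le)
                (by norm_num)
    _ ≤ (∫⁻ γ, (⟨γ.walk.toCurve (meshPoint δ)⟩ : Curve ℂ).pVariation p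
          ∂(SAW.law D.carrier δ (a δ) (b δ))) / m :=
        meas_ge_le_lintegral_div hmeas hm0 hmtop
    _ ≤ C / m := ENNReal.div_le_div_right (hbound δ hδ) m
    _ ≤ ENNReal.ofReal θ := by
        rw [hm, ENNReal.div_le_iff hm0 hmtop]
        calc C ≤ C + 1 := le_self_add
          _ = ENNReal.ofReal θ * ((C + 1) / ENNReal.ofReal θ) := by
              rw [ENNReal.mul_div_cancel hθ' ENNReal.ofReal_ne_top]

/-- **`PVarMomentsTight` (stmt-CriticalPhenomena-5892)**: `PVarMoments → EventualTight` for route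
`SAWExpectedSignature` — moment bounds on the `p`-variation of the pushed critical SAW polylines
(`n = 1` suffices) give eventual tightness of their laws along the mesh: Markov, exponent
monotonicity to `V_2`, the rung `eventualTight_of_pVariationTight` (AB99 Lemma 4.1), and the
set-form → along-mesh bridge. [cite: AizenmanBurchardDuke1999, Lemma 4.1] -/
theorem PVarMomentsTight_proof : SAWExpectedSignature.PVarMomentsTight := by
  intro hPM
  -- Step 1–2: tightness of `V_2`, uniformly on an initial mesh interval, for every domain
  have hV2 : ∀ (D : DobrushinDomain) (a b : ℝ → Site 2), SAW.IsEndpointApprox D a b →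
      ∃ δ₀ : ℝ, 0 < δ₀ ∧ ∀ θ : ℝ, 0 < θ → ∃ M : ℝ, 0 ≤ M ∧ ∀ δ ∈ Set.Ioc (0 : ℝ) δ₀,
        SAW.law D.carrier δ (a δ) (b δ)
          {γ | ENNReal.ofReal M < (⟨γ.walk.toCurve (meshPoint δ)⟩ : Curve ℂ).pVariation 2} ≤
          ENNReal.ofReal θ := by
    intro D a b hab
    obtain ⟨p, hp1, hp2, δ₀, hδ₀, hmom⟩ := hPM D a b hab
    obtain ⟨C, hC, hbound⟩ := hmom 1
    refine ⟨δ₀, hδ₀, fun θ hθ => ?_⟩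
    refine exists_level_pVariation_two_le_of_lintegral_le (one_pos.trans_le hp1) hp2.le hC
      (fun δ hδ => ?_) hθ
    have h := hbound δ hδ
    simp only [Nat.cast_one, ENNReal.rpow_one] at h
    exact h
  -- Step 3: the rung (set-level tightness) and the along-mesh bridge
  have hT : SAWWeldingIdentification.EventualTight :=
    eventualTight_of_pVariationTight (p := 2) (by norm_num) hV2
  intro D a b hab
  obtain ⟨δ₀, hδ₀, h⟩ := hT D a b hab
  exact isTightAlongMesh_of_isTightMeasureSet_image
    (Eventually.of_forall fun δ => (SAW.DomainSAW.measurable_of_top _).aemeasurable) hδ₀ h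

end Summit.CriticalPhenomena.SAWScalingLimit.Theorems

end
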